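import Summits.QuantumFields.YangMills.Theses.UnitScaleTilt
import HarnessLib

/-!
# `UnitScaleTiltAdmissibleBlocks` — the route's composition READ PER BLOCK SIZE, and the admissible-block / floored closers

Route `route-QuantumFields-UnitScaleTilt` closes the rung-R3 leaf `T3YM3TorusStatement.YM3TorusSU2` (every odd block size `L > 1`)
from its three cruxes `MinimiserStabilityRegPr` (stmt-QuantumFields-19200), `FluctuationComparisonRegPrL` (19935), `HistoryTailL`
(19936) by `Theses.UnitScaleTilt.closes`.  Each crux is a `∀ L` statement and the composition never mixes block sizes.  This file
records that fact in the kernel: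

* §1 `yM3TorusSU2At_of_cruxBodies` — for ONE block size `L₀`: the three crux BODIES at `L₀` (spelled inline, no new definition)
  give the fixed-block-size leaf `T3YM3TorusStatement.YM3TorusSU2At L₀` (the `closes` argument verbatim, `γ₁ = 1` and refinement).
* §2 the FLOORED closers: if the fluctuation-comparison crux is only available above a block-size floor `L₁` (the shape repair
  (R3) of the cell's FINDING #44/#56 would give it: the registered line of 19935 carries its small-block residue as STUB 4′
  `stub_logComparisonSmallBlocks`, odd `L < 7`), the two other cruxes BY NAME still give `YM3TorusSU2At L₀` for every `L₀ ≥ L₁`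
  (`yM3TorusSU2At_of_cruxes_from`), and with `L₁ ≤ 12` the print-faithful admissible-block leaf `T3YM3TorusStatement.YM3TorusSU2Adm`
  (odd `L₀ > 11`, [Balaban1987RG1] §0 p. 251) BY NAME (`yM3TorusSU2Adm_of_cruxes_from`, `yM3TorusSU2Adm_of_cruxes_from7`).
* §3 sanity: the unfloored cruxes give every `YM3TorusSU2At L₀` (through `closes` and `YM3TorusSU2.at`).

Pure bookkeeping over tree theorems (`T3UnitScaleTilt.continuumYM3Torus_of_unitTiltAt_historyTailAt`,
`T3PrintedRegularMinimiser.heightSandwich_unitTilt_of_regPr`); nothing of Bałaban's or King's is asserted, no crux is assumed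
outside the hypotheses, and NO statement about which block sizes the cruxes hold for is made here.
-/

namespace Summit.QuantumFields.YangMills.Theorems

open Literature.MathematicalPhysics.QuantumFieldTheory
open Literature.MathematicalPhysics.QuantumFieldTheory.Balaban1983to89
open Literature.MathematicalPhysics.QuantumFieldTheory.Balaban1983to89.T3ContinuumYM3Torus
open Literature.MathematicalPhysics.QuantumFieldTheory.Balaban1983to89.T3YM3TorusStatement
open Summit.QuantumFields.YangMills.Theses.UnitScaleTilt

/-! ## §1 The composition at one block size -/

/-- **THE ROUTE'S COMPOSITION AT ONE BLOCK SIZE.**  For a fixed block size `L₀`: the body of `MinimiserStabilityRegPr` at `L₀`,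
the body of `FluctuationComparisonRegPrL` at `L₀` and the body of `HistoryTailL` at `L₀` give the fixed-block-size rung statement
`YM3TorusSU2At L₀` — with the threshold `γ₁ = 1`: for `γ ≤ 1` one passes to the refined family `F.refine n` at coupling `γL₀^{-n}`
below all three crux thresholds (`T3ThresholdRemoval`), exactly as in `Theses.UnitScaleTilt.closes`.
[cite: Balaban1985UV3, (1)-(3) p.256] -/
theorem yM3TorusSU2At_of_cruxBodies (L₀ : ℕ)
    (h200 : ∃ ε₁ : ℝ, 0 < ε₁ ∧ ∀ (ε₀ : ℝ), 0 < ε₀ → ε₀ ≤ ε₁ → ∃ m₀ : ℕ, ∀ (m : ℕ), m₀ ≤ m → ∀ (b₀ p₀ : ℝ), 0 < b₀ → 2 < p₀ →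
      ∃ γ₁ : ℝ, 0 < γ₁ ∧ ∀ (F : T3Family) (γ : ℝ), F.L = L₀ → 0 < γ → γ ≤ γ₁ →
        T3PrintedRegularMinimiser.MinimiserStabilityRegPrAt F γ b₀ p₀ m ε₀)
    (h201 : ∃ (b₁ p₁ : ℝ), ∀ (b₀ p₀ : ℝ), b₁ ≤ b₀ → p₁ ≤ p₀ → 0 < b₀ → 2 < p₀ → ∃ ε₁ : ℝ, 0 < ε₁ ∧ ∀ (ε₀ : ℝ), 0 < ε₀ → ε₀ ≤ ε₁ →
      ∃ m₀ : ℕ, ∀ (m : ℕ), m₀ ≤ m → ∃ γ₁ : ℝ, 0 < γ₁ ∧ ∀ (F : T3Family) (γ : ℝ), F.L = L₀ → 0 < γ → γ ≤ γ₁ →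
        T3PrintedRegularMinimiser.FluctuationComparisonRegPrAt F γ b₀ p₀ m ε₀)
    (hK2 : ∀ (b₁ p₁ : ℝ), ∃ (b₀ p₀ : ℝ), b₁ ≤ b₀ ∧ p₁ ≤ p₀ ∧ 0 < b₀ ∧ 2 < p₀ ∧ ∀ (m : ℕ), 0 < m →
      ∃ γ₁ : ℝ, 0 < γ₁ ∧ ∀ (F : T3Family) (γ : ℝ), F.L = L₀ → 0 < γ → γ ≤ γ₁ → T3UnitScaleTilt.HistoryTailAt F γ b₀ p₀ m) :
    YM3TorusSU2At L₀ := by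
  refine ⟨1, one_pos, fun F γ hFL hγ _ => ?_⟩
  obtain ⟨b₁, p₁, hB⟩ := h201
  obtain ⟨b₀, p₀, hb₁, hp₁, hb₀, hp₀, hT⟩ := hK2 b₁ p₁
  obtain ⟨ε₁, hε₁, hA⟩ := h200
  obtain ⟨ε₁', hε₁', hB'⟩ := hB b₀ p₀ hb₁ hp₁ hb₀ hp₀
  obtain ⟨m₁, hm₁⟩ := hA (min ε₁ ε₁') (lt_min hε₁ hε₁') (min_le_left _ _)
  obtain ⟨m₂, hm₂⟩ := hB' (min ε₁ ε₁') (lt_min hε₁ hε₁') (min_le_right _ _)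
  obtain ⟨γ₂, hγ₂, hT'⟩ := hT (max (max m₁ m₂) 1) (lt_of_lt_of_le Nat.one_pos (le_max_right _ _))
  obtain ⟨γ₃, hγ₃, hA'⟩ := hm₁ (max (max m₁ m₂) 1) ((le_max_left _ _).trans (le_max_left _ _)) b₀ p₀ hb₀ hp₀
  obtain ⟨γ₄, hγ₄, hB''⟩ := hm₂ (max (max m₁ m₂) 1) ((le_max_right _ _).trans (le_max_left _ _))
  have hL : (1 : ℝ) < F.L := by exact_mod_cast F.hL.2
  have hL0 : (0 : ℝ) < F.L := zero_lt_one.trans hL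
  obtain ⟨n, hn⟩ := ((tendsto_pow_atTop_nhds_zero_of_lt_one (inv_nonneg.mpr hL0.le)
    (inv_lt_one_of_one_lt₀ hL)).eventually (ge_mem_nhds (div_pos (lt_min hγ₂ (lt_min hγ₃ hγ₄)) hγ))).exists
  have hpos : 0 < γ * ((F.L : ℝ)⁻¹) ^ n := mul_pos hγ (pow_pos (inv_pos.mpr hL0) n)
  have hle : γ * ((F.L : ℝ)⁻¹) ^ n ≤ min γ₂ (min γ₃ γ₄) := by
    have e := mul_le_mul_of_nonneg_left hn hγ.le
    rwa [mul_div_cancel₀ _ hγ.ne'] at e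
  have hrL : (F.refine n).L = L₀ := hFL
  exact T3UnitScaleTilt.continuumYM3Torus_of_unitTiltAt_historyTailAt F hγ.le n
    (T3PrintedRegularMinimiser.heightSandwich_unitTilt_of_regPr hpos.le
      (hA' (F.refine n) _ hrL hpos (hle.trans ((min_le_right _ _).trans (min_le_left _ _))))
      (hB'' (F.refine n) _ hrL hpos (hle.trans ((min_le_right _ _).trans (min_le_right _ _))))).2
    (hT' (F.refine n) _ hrL hpos (hle.trans (min_le_left _ _)))

/-! ## §2 The floored closers -/

/-- **FLOORED FLUCTUATION COMPARISON STILL CLOSES EVERY BLOCK SIZE ABOVE THE FLOOR.**  If the minimiser-stability and history-tail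
cruxes hold BY NAME and the fluctuation-comparison crux's body holds for every block size `L ≥ L₁`, then `YM3TorusSU2At L₀` holds
for every `L₀ ≥ L₁`. [cite: Balaban1985UV3, (1)-(3) p.256] -/
theorem yM3TorusSU2At_of_cruxes_from (L₁ : ℕ) (h200 : MinimiserStabilityRegPr)
    (h201 : ∀ L : ℕ, L₁ ≤ L → ∃ (b₁ p₁ : ℝ), ∀ (b₀ p₀ : ℝ), b₁ ≤ b₀ → p₁ ≤ p₀ → 0 < b₀ → 2 < p₀ → ∃ ε₁ : ℝ, 0 < ε₁ ∧
      ∀ (ε₀ : ℝ), 0 < ε₀ → ε₀ ≤ ε₁ → ∃ m₀ : ℕ, ∀ (m : ℕ), m₀ ≤ m → ∃ γ₁ : ℝ, 0 < γ₁ ∧ ∀ (F : T3Family) (γ : ℝ), F.L = L →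
        0 < γ → γ ≤ γ₁ → T3PrintedRegularMinimiser.FluctuationComparisonRegPrAt F γ b₀ p₀ m ε₀)
    (hK2 : HistoryTailL) : ∀ L₀ : ℕ, L₁ ≤ L₀ → YM3TorusSU2At L₀ :=
  fun L₀ hL₀ => yM3TorusSU2At_of_cruxBodies L₀ (h200 L₀) (h201 L₀ hL₀) (hK2 L₀)

/-- The same with the floor stated on ADMISSIBLE block sizes only (`Odd L ∧ L₁ ≤ L`): inadmissible block sizes carry no family, so
`YM3TorusSU2At L₀` holds there vacuously (`yM3TorusSU2At_of_not_admissible`). [cite: Balaban1985UV3, (1)-(3) p.256] -/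
theorem yM3TorusSU2At_of_cruxes_from_odd (L₁ : ℕ) (h200 : MinimiserStabilityRegPr)
    (h201 : ∀ L : ℕ, Odd L → L₁ ≤ L → ∃ (b₁ p₁ : ℝ), ∀ (b₀ p₀ : ℝ), b₁ ≤ b₀ → p₁ ≤ p₀ → 0 < b₀ → 2 < p₀ → ∃ ε₁ : ℝ, 0 < ε₁ ∧
      ∀ (ε₀ : ℝ), 0 < ε₀ → ε₀ ≤ ε₁ → ∃ m₀ : ℕ, ∀ (m : ℕ), m₀ ≤ m → ∃ γ₁ : ℝ, 0 < γ₁ ∧ ∀ (F : T3Family) (γ : ℝ), F.L = L →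
        0 < γ → γ ≤ γ₁ → T3PrintedRegularMinimiser.FluctuationComparisonRegPrAt F γ b₀ p₀ m ε₀)
    (hK2 : HistoryTailL) : ∀ L₀ : ℕ, L₁ ≤ L₀ → YM3TorusSU2At L₀ := by
  intro L₀ hL₀
  by_cases hadm : Odd L₀ ∧ 1 < L₀
  · exact yM3TorusSU2At_of_cruxBodies L₀ (h200 L₀) (h201 L₀ hadm.1 hL₀) (hK2 L₀)
  · exact yM3TorusSU2At_of_not_admissible hadm

/-- **THE ADMISSIBLE-BLOCK LEAF FROM FLOORED CRUXES.**  With the fluctuation-comparison crux's body available for every odd block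
size `L ≥ L₁`, `L₁ ≤ 12`, and the two other cruxes BY NAME, the print-faithful admissible-block form `YM3TorusSU2Adm` (every odd
`L₀ > 11`, [Balaban1987RG1] §0 p. 251) holds. [cite: Balaban1987RG1, §0 p.251] -/
theorem yM3TorusSU2Adm_of_cruxes_from {L₁ : ℕ} (hL₁ : L₁ ≤ 12) (h200 : MinimiserStabilityRegPr)
    (h201 : ∀ L : ℕ, Odd L → L₁ ≤ L → ∃ (b₁ p₁ : ℝ), ∀ (b₀ p₀ : ℝ), b₁ ≤ b₀ → p₁ ≤ p₀ → 0 < b₀ → 2 < p₀ → ∃ ε₁ : ℝ, 0 < ε₁ ∧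
      ∀ (ε₀ : ℝ), 0 < ε₀ → ε₀ ≤ ε₁ → ∃ m₀ : ℕ, ∀ (m : ℕ), m₀ ≤ m → ∃ γ₁ : ℝ, 0 < γ₁ ∧ ∀ (F : T3Family) (γ : ℝ), F.L = L →
        0 < γ → γ ≤ γ₁ → T3PrintedRegularMinimiser.FluctuationComparisonRegPrAt F γ b₀ p₀ m ε₀)
    (hK2 : HistoryTailL) : YM3TorusSU2Adm :=
  fun L₀ hodd h11 => yM3TorusSU2At_of_cruxes_from_odd L₁ h200 h201 hK2 L₀ (by omega)

/-- **THE FLOOR OF THE CELL'S FINDING #44/#56 (`7 ≤ L`).**  If the fluctuation-comparison body holds for every odd block size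
`L ≥ 7` (the registered line of 19935 minus its small-block STUB 4′), then with the two other cruxes BY NAME: `YM3TorusSU2At L₀`
for every `L₀ ≥ 7`, and `YM3TorusSU2Adm`. [cite: Balaban1987RG1, §0 p.251] -/
theorem yM3TorusSU2Adm_of_cruxes_from7 (h200 : MinimiserStabilityRegPr)
    (h201 : ∀ L : ℕ, Odd L → 7 ≤ L → ∃ (b₁ p₁ : ℝ), ∀ (b₀ p₀ : ℝ), b₁ ≤ b₀ → p₁ ≤ p₀ → 0 < b₀ → 2 < p₀ → ∃ ε₁ : ℝ, 0 < ε₁ ∧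
      ∀ (ε₀ : ℝ), 0 < ε₀ → ε₀ ≤ ε₁ → ∃ m₀ : ℕ, ∀ (m : ℕ), m₀ ≤ m → ∃ γ₁ : ℝ, 0 < γ₁ ∧ ∀ (F : T3Family) (γ : ℝ), F.L = L →
        0 < γ → γ ≤ γ₁ → T3PrintedRegularMinimiser.FluctuationComparisonRegPrAt F γ b₀ p₀ m ε₀)
    (hK2 : HistoryTailL) : (∀ L₀ : ℕ, 7 ≤ L₀ → YM3TorusSU2At L₀) ∧ YM3TorusSU2Adm :=
  ⟨yM3TorusSU2At_of_cruxes_from_odd 7 h200 h201 hK2, yM3TorusSU2Adm_of_cruxes_from (by norm_num) h200 h201 hK2⟩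

/-! ## §3 Sanity: the unfloored cruxes give every fixed-block-size statement -/

/-- With all three cruxes BY NAME (no floor) every fixed-block-size statement holds — through the route's own `closes` and
`YM3TorusSU2.at`; equivalently block size by block size through §1. [cite: Balaban1985UV3, (1)-(3) p.256] -/
theorem yM3TorusSU2At_of_cruxes (h200 : MinimiserStabilityRegPr) (h201 : FluctuationComparisonRegPrL) (hK2 : HistoryTailL)
    (L₀ : ℕ) : YM3TorusSU2At L₀ :=
  -- ops-buildfix-2 g26 (2026-08-27): proof-only re-glue after route UnitScaleTilt rev 14 re-typed `closes` over
  -- `FluctuationComparisonRegPrIntL`; the statement is unchanged and now goes block size by block size through §2/§1.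
  yM3TorusSU2At_of_cruxes_from 0 h200 (fun L _ => h201 L) hK2 L₀ (Nat.zero_le _)

end Summit.QuantumFields.YangMills.Theorems
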